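import Summits.FinalStateConjecture.FinalStateConjecture.Theses.BartnikGapSettling
import Summits.FinalStateConjecture.FinalStateConjecture.Theorems.GapExhaustion.Negative.GapExhaustionFalseOfFarWildBlackHole
import Literature.Geometry.Lorentzian.BondiBartnikGap
import Literature.Geometry.Lorentzian.NearKerrCollarCore
import Literature.Geometry.Lorentzian.CollarMargin

/-!
# `GapExhaustion` (stmt-FinalStateConjecture-10808) — crux-strategist s1: typed companion of
# `STRATEGY-CENSUS.md` (2026-08-17)

Scratch file of the crux-strategist seat `planner-cstrat-stmt-FinalStateConjecture-10808-s1-0`;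
NOT a tree proposal, NOT a statement item, NOT a registrable line (no `GapExhaustion_of`, no
`stub_*` — on purpose, §0 says why). It reads with `STRATEGY-CENSUS.md` (same folder).

* §0 `## Negation` / every heading — the kernel form of "no line and no split on the FILED decl":
  `filed_line_inherits_false_stub`, `filed_split_inherits_false_piece` (pure logic over the landed
  negative lemma `GapExhaustion_false_of_farWildBlackHoleExists`, p108531).
* §1–§2 — the clause- and development-level texts of the c3/c4 restatement, VERBATIM from
  `RESTATED_c4.lean` rev 3 (crux workfiles are not importable), except that the windowed margin
  keeps the filed `∃ k₁` (10809 lead a1, ORDER-AND-TAILS (1): the generic third law is a 3-jet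
  statement; under far-regularity R7 the window alone kills junk at every order `≥ 2`).
* §3 `## Decomposition` — the best typed split of the crux's CONTENT, as signatures:
  `GapExhaustionC4 ⇐ LateCollaredLeavesC4 ∧ OwnEnergyExhaustion` with the glue
  `gapExhaustionC4_of_pieces` PROVED; the competitor floor `KerrCollarMinimalityWindowed` (KCM′,
  O1) is typed separately because the restated 10808 no longer consumes it (R3: own-energy form).
* §4 — the restated chain CLOSES AGAINST THE CURRENT (T2, rev 6) ROUTE: `closes_s1 :
  BondiBartnikRigidityC4 → GapExhaustionC4 → MultiCollarFate → SettledCapture →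
  TameCensorshipFarRegularCollarMargin → MGHDExists → FinalStateConjecture`, sorry-free — the
  c4 assembly re-proved with `SettledCapture` (stmt-17328) in place of the dropped `Capture` and
  TAME genericity (`IsTameChristodoulouGeneric`, one fixed end) in place of
  `IsChristodoulouGeneric`. This is the certified glue a tenure `route edit --restate` needs;
  nothing is asserted about the truth of any restated item.
-/

noncomputable section

-- D-0017: single-problem summit, `Summit.<S>.<S>.…` by design (cf. lakefile `weak.linter.dupNamespace`).
set_option linter.dupNamespace false

namespace Summit.FinalStateConjecture.FinalStateConjecture.Cruxes.GapExhaustion.RestatedS1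

open Literature.Geometry.Lorentzian
open Set Filter Topology
open scoped Manifold ContDiff Topology ENNReal BigOperators

/-! ## §0 No line and no split on the FILED decl (kernel form of the census verdict) -/

open Summit.FinalStateConjecture.FinalStateConjecture.Theses.BartnikGapSettling
  (GapExhaustion SettledCapture MGHDExists)
open Summit.FinalStateConjecture.FinalStateConjecture.Theorems.GapExhaustion.Negative
  (FarWildBlackHoleExists GapExhaustion_false_of_farWildBlackHoleExists)

/-- **Every line to the filed decl has a stub false modulo `FarWildBlackHoleExists`.** If a
conjunction of stubs `S` implies the FILED `GapExhaustion`, then `S` fails on the far-wild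
black-hole development (p108531). With `S :=` the four registered stubs of `Lines/Sketch.lean` this
is the line-dead certificate of c5 (there the dying stub is named: A⁺, p115847); with `S :=` any
future stub set it is the reason this seat registers no alternative line. [folklore] -/
theorem filed_line_inherits_false_stub {S : Prop} (h : S → GapExhaustion) :
    FarWildBlackHoleExists → ¬ S :=
  fun H hS => GapExhaustion_false_of_farWildBlackHoleExists H (h hS)

/-- **Every typed split of the filed decl has a piece false modulo `FarWildBlackHoleExists`**
(the shape `Sub₁ → Sub₂ → Sub₃ → GapExhaustion` of a strategist's `GapExhaustion_of_subs`):
modulo `H`, not all three pieces hold — so a `route edit --split` of the FILED parent would file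
at least one believed-false item for staffing. [folklore] -/
theorem filed_split_inherits_false_piece {Sub₁ Sub₂ Sub₃ : Prop}
    (h : Sub₁ → Sub₂ → Sub₃ → GapExhaustion) (H : FarWildBlackHoleExists) :
    ¬ (Sub₁ ∧ Sub₂ ∧ Sub₃) :=
  fun hs => GapExhaustion_false_of_farWildBlackHoleExists H (h hs.1 hs.2.1 hs.2.2)

/-- **Dually, the filed decl cannot be refuted short of constructing `H`-type objects**: any
refutation exhibits an admissible datum, a maximal development with complete `𝓘⁺` AND a collar
margin (the item's three hypotheses) on which the conclusion fails — in particular it proves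
`MGHDExists`-instances and complete-`𝓘⁺` instances the tree has for no datum. Recorded as the
trivial direction: a refutation yields a development meeting the hypotheses. [folklore] -/
theorem refutation_exhibits_margined_development (h : ¬ GapExhaustion) :
    ∃ (X : Type) (_ : TopologicalSpace X) (_ : ChartedSpace E3 X) (_ : IsManifold (𝓡 3) ∞ X)
      (_ : T2Space X) (_ : SecondCountableTopology X) (_ : ConnectedSpace X)
      (D : InitialDataSet (𝓡 3) X) (_ : D ∈ admissibleVacuumData X)
      (𝒟 : VacuumCauchyDevelopment D), 𝒟.IsMaximal ∧
        Summit.FinalStateConjecture.HasCompleteNullInfinity 𝒟.toCauchyDevelopment ∧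
        𝒟.CollarMargin := by
  by_contra hne
  apply h
  intro X _ _ _ _ _ _ D hD 𝒟 hmax hcni hcm
  have h3 : 𝒟.IsMaximal ∧
      Summit.FinalStateConjecture.HasCompleteNullInfinity 𝒟.toCauchyDevelopment ∧ 𝒟.CollarMargin :=
    And.intro hmax (And.intro hcni hcm)
  exact absurd ⟨X, ‹_›, ‹_›, ‹_›, ‹_›, ‹_›, ‹_›, D, hD, 𝒟, h3⟩ hne

/-! ## §1 Clause level — verbatim from `RESTATED_c4.lean` rev 3 (R1 window), margin order `∃ k₁` -/

section Spacetime

variable (𝓢 : Spacetime.{0} 4)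

/-- **Thick collar chart block at order `k`, tolerance `δ`** (clauses (C1)–(C3) of
`NearKerrCollarCore`, for ONE chart): `B` is the boosted Kerr star background of label `(M, a)`
and motion `mo = (Λ, c)`, `Φ` is smooth on the collar layer `{−1 < t* < 1, r < 3M + 1}` and an
open embedding of it, and the `Cᵏ` deviation of `Φ^* g` from boosted Kerr on the thick slab
`{t* = 0, r ≤ 3M}` is `≤ δ`. Verbatim the filed block with `k`, `δ` as parameters. -/
def IsThickCollarChart (k : ℕ) (δ : ℝ≥0∞) (M a : ℝ) (mo : lorentzGroup × E4)
    (B : ModelBackground) (Φ : B.domain → 𝓢.carrier) : Prop :=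
  B = starBackground mo.1 mo.2 M a (fun x => Kerr.radius a (poincareInv mo.1 mo.2 x)) ∧
  ContMDiffOn 𝓘(ℝ, E4) (𝓡 4) ∞ Φ
      {x | -1 < B.time x.1 ∧ B.time x.1 < 1 ∧ B.radius x.1 < 3 * M + 1} ∧
  IsOpenEmbedding
      ({x | -1 < B.time x.1 ∧ B.time x.1 < 1 ∧ B.radius x.1 < 3 * M + 1}.restrict Φ) ∧
  𝓢.truncDeviationCk B Φ k (3 * M) 0 ≤ δ

variable {𝓢}

/-- The chart block is antitone in the order and monotone in the tolerance
(`supCkENorm_mono_right`). [folklore] -/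
theorem IsThickCollarChart.mono {k k' : ℕ} {δ δ' : ℝ≥0∞} {M a : ℝ} {mo : lorentzGroup × E4}
    {B : ModelBackground} {Φ : B.domain → 𝓢.carrier}
    (h : IsThickCollarChart 𝓢 k' δ M a mo B Φ) (hk : k ≤ k') (hδ : δ ≤ δ') :
    IsThickCollarChart 𝓢 k δ' M a mo B Φ :=
  ⟨h.1, h.2.1, h.2.2.1, ((supCkENorm_mono_right _ hk _).trans h.2.2.2).trans hδ⟩

variable (𝓢)

/-- **R1 + R4: windowed collar-margin datum at order `k₁`.** Every thick collar chart with label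
in the window `m₀ ≤ M₁ ≤ m₀⁻¹`, `|a₁| ≤ M₁`, `δ₁`-close in `C^{k₁}` to boosted Kerr on its thick
slab and with slab image disjoint from `J⁻(K₁)`, has `|a₁| ≤ χ₁ M₁`. (10809-c1's clause C″ with
the chart block folded; the filed `HasCollarMargin` is the case "no window".) -/
def HasWindowedCollarMargin (m₀ χ₁ : ℝ) (k₁ : ℕ) (δ₁ : ℝ≥0∞) (K₁ : Set 𝓢.carrier) : Prop :=
  ∀ (M₁ a₁ : ℝ) (mo₁ : lorentzGroup × E4) (B₁ : ModelBackground) (Φ₁ : B₁.domain → 𝓢.carrier),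
    m₀ ≤ M₁ → M₁ ≤ m₀⁻¹ → |a₁| ≤ M₁ →
    IsThickCollarChart 𝓢 k₁ δ₁ M₁ a₁ mo₁ B₁ Φ₁ →
    Disjoint (Φ₁ '' B₁.truncTimeSlab (3 * M₁) 0) (𝓢.metric.causalPast 𝓢.timeOrientation K₁) →
    |a₁| ≤ χ₁ * M₁

/-- **The restated margin (hypothesis of 10808′, second conjunct of 10809′), filed order kept.**
For EVERY window `[m₀, m₀⁻¹]` there are a ratio `χ₁ < 1`, an order `k₁`, a size `δ₁ > 0` and a
compact `K₁` such that the windowed collar-margin datum holds at order `k₁`. (c4 rev 3 fixed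
`k₁ = 2`; the 10809 lead a1 asked to keep the filed `∃ k₁` — the generic third law is a 3-jet
statement — which is consumable once far-regularity R7 is a hypothesis: configurations are produced
at order `max k k₁` and transported down.) Junk charts (far-field mimicry `M₁ → ∞`, micro-collars
`M₁ → 0`) lie outside every window. -/
def WindowedCollarMargin : Prop :=
  ∀ m₀ : ℝ, 0 < m₀ →
    ∃ (χ₁ : ℝ) (k₁ : ℕ) (δ₁ : ℝ≥0∞) (K₁ : Set 𝓢.carrier), χ₁ < 1 ∧ 0 < δ₁ ∧ IsCompact K₁ ∧
      HasWindowedCollarMargin 𝓢 m₀ χ₁ k₁ δ₁ K₁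

variable {𝓢}

/-- The filed (unwindowed) margin gives the windowed one (same order, every window). [folklore] -/
theorem windowedCollarMargin_of_collarMargin (h : 𝓢.CollarMargin) : WindowedCollarMargin 𝓢 := by
  intro m₀ hm₀
  obtain ⟨χ₁, k₁, δ₁, K₁, hχ₁, hδ₁, hK₁, h⟩ := h
  refine ⟨χ₁, k₁, δ₁, K₁, hχ₁, hδ₁, hK₁, ?_⟩
  intro M₁ a₁ mo₁ B₁ Φ₁ hlo _ ha hch hdisj
  exact h M₁ a₁ mo₁ B₁ Φ₁ (hm₀.trans_le hlo) ha hch.1 hch.2.1 hch.2.2.1 hch.2.2.2 hdisj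

/-- **Order `2` is the strongest order `≥ 2`.** A windowed margin datum at order `k₁` is one at
every order `k₁' ≥ k₁` (a chart quiet in `C^{k₁'}` is quiet in `C^{k₁}`). [folklore] -/
theorem HasWindowedCollarMargin.of_order_le {m₀ χ₁ : ℝ} {k₁ k₁' : ℕ} {δ₁ : ℝ≥0∞}
    {K₁ : Set 𝓢.carrier} (h : HasWindowedCollarMargin 𝓢 m₀ χ₁ k₁ δ₁ K₁) (hk : k₁ ≤ k₁') :
    HasWindowedCollarMargin 𝓢 m₀ χ₁ k₁' δ₁ K₁ :=
  fun M₁ a₁ mo₁ B₁ Φ₁ hlo hhi ha hch hdisj =>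
    h M₁ a₁ mo₁ B₁ Φ₁ hlo hhi ha (hch.mono hk le_rfl) hdisj

/-- A windowed margin datum is monotone in the size and in the compact set. [folklore] -/
theorem HasWindowedCollarMargin.mono {m₀ χ₁ : ℝ} {k₁ : ℕ} {δ₁ δ₁' : ℝ≥0∞}
    {K₁ K₁' : Set 𝓢.carrier} (h : HasWindowedCollarMargin 𝓢 m₀ χ₁ k₁ δ₁ K₁) (hδ : δ₁' ≤ δ₁)
    (hK : K₁ ⊆ K₁') : HasWindowedCollarMargin 𝓢 m₀ χ₁ k₁ δ₁' K₁' := by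
  intro M₁ a₁ mo₁ B₁ Φ₁ hlo hhi ha hch hdisj
  have hJ : 𝓢.metric.causalPast 𝓢.timeOrientation K₁ ⊆
      𝓢.metric.causalPast 𝓢.timeOrientation K₁' :=
    LorentzianMetric.causalFuture_mono hK
  exact h M₁ a₁ mo₁ B₁ Φ₁ hlo hhi ha (hch.mono le_rfl hδ) (hdisj.mono_right hJ)

end Spacetime

/-! ## §2 Development level — verbatim from `RESTATED_c4.lean` rev 3 (R7, F1-repaired end, F2/F3/F5/F6 configuration) -/

section Development

variable {X : Type} [TopologicalSpace X] [ChartedSpace E3 X] [IsManifold (𝓡 3) ∞ X]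
  [ConnectedSpace X] {D : InitialDataSet (𝓡 3) X}

/-- **R7: far-regular data.** The datum is strongly asymptotically flat at the
Dafermos–Rodnianski rates `h = (1 + 2M/r)δ + o_n(r⁻¹)`, `k = o_n(r⁻²)` to EVERY derivative order
`n` on a sole asymptotically flat end (`AFEnd.IsStronglyAsymptoticallyFlatWith … 1 2 n n`).
Admissibility is the case `n = (2, 1)`; data equal to Kerr outside a compact set are far-regular.
Far-wild admissible tails (`C²`-quiet, `C³`-wild) are excluded — they can be, because they are
not Christodoulou-generic (AUDIT-c4 F6). -/
def IsFarRegular (D : InitialDataSet (𝓡 3) X) : Prop :=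
  ∀ n : ℕ, ∃ (e : AFEnd X) (M : ℝ), e.IsSoleEnd ∧ e.IsStronglyAsymptoticallyFlatWith D M 1 2 n n

omit [ConnectedSpace X] in
/-- Sanity: every admissible datum is far-regular to order `(2, 1)` (that is all admissibility
gives; `IsFarRegular` asks it for every `n`). [folklore] -/
theorem isFarRegular_admissible_order_two (hD : D ∈ admissibleVacuumData X) :
    ∃ (e : AFEnd X) (M : ℝ), e.IsSoleEnd ∧ e.IsStronglyAsymptoticallyFlatWith D M 1 2 2 1 :=
  hD.2

/-- **F1 repaired — an honest asymptotically flat end through `S`, at order `k`, with profile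
`prof`.** As c3's clause, but (i) the flat domain `U₀` must CONTAIN the exterior
`{t₀ > −1, |x̲| ≥ R₀}` of the hyperboloidal layer for some `R₀` — the chart is then an open
embedding of an unbounded end of the layer `{−1 < t₀ < 1}` — and (ii) the deviation is measured in
`Cᵏ`: on `{t₀ = 0, |x̲| ≥ R}` it is `≤ prof R` for EVERY `R` (with `prof R → 0` demanded by the
item). A compressed bowl has deviation `≍ ‖η‖` everywhere and fails it; so does `U₀ = ⊥`. -/
def HasHonestFlatEnd (𝒟 : VacuumCauchyDevelopment D) (k : ℕ) (S : Set 𝒟.carrier)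
    (prof : ℝ → ℝ≥0∞) : Prop :=
  ∃ (R₀ : ℝ) (U₀ : TopologicalSpace.Opens E4) (Ψ₀ : (hypBackground U₀).domain → 𝒟.carrier),
    {x : E4 | -1 < x 0 - Real.sqrt (1 + E4.spatialNorm x ^ 2) ∧ R₀ ≤ E4.spatialNorm x} ⊆
        (U₀ : Set E4) ∧
    ContMDiffOn 𝓘(ℝ, E4) (𝓡 4) ∞ Ψ₀
        {x | -1 < (hypBackground U₀).time x.1 ∧ (hypBackground U₀).time x.1 < 1} ∧
    IsOpenEmbedding
        ({x | -1 < (hypBackground U₀).time x.1 ∧ (hypBackground U₀).time x.1 < 1}.restrict Ψ₀) ∧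
    Ψ₀ '' {x | -1 < (hypBackground U₀).time x.1 ∧ (hypBackground U₀).time x.1 < 1} ⊆
        𝒟.metric.causalFuture 𝒟.timeOrientation (range 𝒟.embed) ∧
    Ψ₀ '' (hypBackground U₀).timeSlab 0 ⊆ S ∧
    ∀ R : ℝ, supCkENorm
        (Subtype.val '' {x | x ∈ (hypBackground U₀).timeSlab 0 ∧ R ≤ E4.spatialNorm x.1}) k
        (𝒟.toSpacetime.deviationExtend (hypBackground U₀) Ψ₀) ≤ prof R

/-- The honest end is antitone in the order. [folklore] -/
theorem HasHonestFlatEnd.mono {𝒟 : VacuumCauchyDevelopment D} {k k' : ℕ}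
    {S : Set 𝒟.carrier} {prof : ℝ → ℝ≥0∞} (h : HasHonestFlatEnd 𝒟 k' S prof) (hk : k ≤ k') :
    HasHonestFlatEnd 𝒟 k S prof := by
  obtain ⟨R₀, U₀, Ψ₀, hU₀, hsm, hemb, hJ, hS, hprof⟩ := h
  exact ⟨R₀, U₀, Ψ₀, hU₀, hsm, hemb, hJ, hS,
    fun R => (supCkENorm_mono_right _ hk _).trans (hprof R)⟩

/-- The domain condition of `HasHonestFlatEnd` is not vacuous: the exterior
`{t₀ > −1, |x̲| ≥ R₀}` of the hyperboloidal layer is nonempty for every `R₀` (it contains the point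
`(√(1 + ρ²), ρ, 0, 0)`, `ρ = max R₀ 0`, of the leaf `{t₀ = 0}`), so `U₀ = ⊥` is excluded. [folklore] -/
theorem exterior_hyperboloidalLayer_nonempty (R₀ : ℝ) :
    ({x : E4 | -1 < x 0 - Real.sqrt (1 + E4.spatialNorm x ^ 2) ∧ R₀ ≤ E4.spatialNorm x}).Nonempty := by
  set ρ : ℝ := max R₀ 0 with hρ
  refine ⟨E4.ofTimeSpace (Real.sqrt (1 + ρ ^ 2)) (EuclideanSpace.single 0 ρ), ?_, ?_⟩
  · have hsn : E4.spatialNorm (E4.ofTimeSpace (Real.sqrt (1 + ρ ^ 2)) (EuclideanSpace.single 0 ρ))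
        = ρ := by
      rw [E4.spatialNorm_ofTimeSpace, PiLp.norm_single, Real.norm_eq_abs,
        abs_of_nonneg (le_max_right _ _)]
    rw [hsn, E4.ofTimeSpace_apply_zero]
    norm_num
  · show R₀ ≤ E4.spatialNorm _
    rw [E4.spatialNorm_ofTimeSpace, PiLp.norm_single, Real.norm_eq_abs,
      abs_of_nonneg (le_max_right _ _)]
    exact le_max_left _ _

/-- **The corrected late configuration at order `k`** (F2: no cap on `N`; F3: `S` ACHRONAL; F6:
order `k` a parameter). `N` holes with labels in the window and margin `χ`, an achronal
`(Λ, k)`-near-Kerr leaf `S` through `p`, `N` thick collar charts `δ`-close at order `k` with slabs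
inside `S` and pairwise disjoint, and — ONLY when `N ≤ 1` — the probe point inside every collar and
an OWN cut Bondi energy of the core `≤ Σ Mᵢ + γ`. For `N ≥ 2` it reports `N` simultaneous
(achronal `S`) margined near-Kerr thick collars and nothing more; the multi-hole sector is exported
to `MultiCollarFate`. -/
def LateCollaredConfigurationC4 (𝒟 : VacuumCauchyDevelopment D) (k : ℕ) (m₀ χ : ℝ)
    (Λ δ : ℝ≥0∞) (γ : ℝ) (N : ℕ) (M a : Fin N → ℝ) (S : Set 𝒟.carrier) (p : 𝒟.carrier)
    (mo : Fin N → lorentzGroup × E4) (B : Fin N → ModelBackground)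
    (Φ : ∀ i, (B i).domain → 𝒟.carrier) : Prop :=
  (∀ i, m₀ ≤ M i ∧ M i ≤ m₀⁻¹ ∧ |a i| ≤ χ * M i) ∧
  𝒟.toCauchyDevelopment.IsNearKerrLeaf k Λ N M a S ∧
  𝒟.metric.IsAchronal 𝒟.timeOrientation S ∧ p ∈ S ∧
  (∀ i, IsThickCollarChart 𝒟.toSpacetime k δ (M i) (a i) (mo i) (B i) (Φ i)) ∧
  (∀ i, Φ i '' (B i).truncTimeSlab (3 * M i) 0 ⊆ S) ∧
  Pairwise (Function.onFun Disjoint fun i => Φ i '' (B i).truncTimeSlab (3 * M i) 0) ∧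
  (N ≤ 1 →
    (∀ i, p ∈ Φ i '' (B i).truncTimeSlab (3 * M i) 0) ∧
    ∃ m : ℝ, 𝒟.toCauchyDevelopment.HasCutBondiMass (collarCore M p B Φ) m ∧ m ≤ (∑ i, M i) + γ)

/-- Monotonicity of the corrected configuration: antitone in the order, monotone in the
tolerances and the budget (`IsNearKerrLeaf.mono`, `IsThickCollarChart.mono`). [folklore] -/
theorem LateCollaredConfigurationC4.mono {𝒟 : VacuumCauchyDevelopment D} {k k' : ℕ} {m₀ χ : ℝ}
    {Λ δ δ' : ℝ≥0∞} {γ γ' : ℝ} {N : ℕ} {M a : Fin N → ℝ} {S : Set 𝒟.carrier} {p : 𝒟.carrier}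
    {mo : Fin N → lorentzGroup × E4} {B : Fin N → ModelBackground}
    {Φ : ∀ i, (B i).domain → 𝒟.carrier}
    (h : LateCollaredConfigurationC4 𝒟 k' m₀ χ Λ δ γ N M a S p mo B Φ) (hk : k ≤ k')
    (hδ : δ ≤ δ') (hγ : γ ≤ γ') :
    LateCollaredConfigurationC4 𝒟 k m₀ χ Λ δ' γ' N M a S p mo B Φ := by
  obtain ⟨hwin, hleaf, hachr, hp, hch, hS, hdisj, hE⟩ := h
  refine ⟨hwin, hleaf.mono hk le_rfl, hachr, hp, fun i => (hch i).mono hk hδ, hS, hdisj,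
    fun h1 => ?_⟩
  obtain ⟨hpin, m, hm, hmle⟩ := hE h1
  exact ⟨hpin, m, hm, hmle.trans (by linarith)⟩

end Development

/-- **10808‴ — `GapExhaustionC4`** (c4 rev 3 verbatim up to the `∃ k₁` margin). For every
admissible FAR-REGULAR datum (R7) and every MGHD `𝒟` with complete `𝓘⁺` satisfying the windowed
collar margin: there are a window `m₀ > 0` and a margin `χ < 1` such that FOR EVERY ORDER `k` there
are ONE geometry bound `Λ < 1` and a profile `prof → 0` such that for every `δ, γ > 0` and every
compact `K`, beyond `J⁻(K)` there is an ACHRONAL late collared configuration at order `k` whose leaf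
carries an honest asymptotically flat end of profile `prof` at order `k`: either `N ≥ 2` simultaneous
margined `δ`-near-Kerr thick collars (no energy claim), or `N ≤ 1`, containing the probe point, with
own cut Bondi energy `≤ Σ Mᵢ + γ`. No competitor quantifier (R3). -/
def GapExhaustionC4 : Prop :=
  ∀ (X : Type) [TopologicalSpace X] [ChartedSpace E3 X] [IsManifold (𝓡 3) ∞ X] [T2Space X]
    [SecondCountableTopology X] [ConnectedSpace X], ∀ D ∈ admissibleVacuumData X,
    IsFarRegular D → ∀ 𝒟 : VacuumCauchyDevelopment D, 𝒟.IsMaximal →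
      Summit.FinalStateConjecture.HasCompleteNullInfinity 𝒟.toCauchyDevelopment →
      WindowedCollarMargin 𝒟.toSpacetime →
      ∃ (m₀ χ : ℝ), 0 < m₀ ∧ χ < 1 ∧ ∀ k : ℕ, ∃ (Λ : ℝ≥0∞) (prof : ℝ → ℝ≥0∞), Λ < 1 ∧
        Tendsto prof atTop (𝓝 0) ∧
        ∀ (δ : ℝ≥0∞) (γ : ℝ), 0 < δ → 0 < γ → ∀ K : Set 𝒟.carrier, IsCompact K →
          ∃ (N : ℕ) (M a : Fin N → ℝ) (S : Set 𝒟.carrier) (p : 𝒟.carrier)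
            (mo : Fin N → lorentzGroup × E4) (B : Fin N → ModelBackground)
            (Φ : ∀ i, (B i).domain → 𝒟.carrier),
            Disjoint (𝒟.metric.causalFuture 𝒟.timeOrientation S)
              (𝒟.metric.causalPast 𝒟.timeOrientation K) ∧
            HasHonestFlatEnd 𝒟 k S prof ∧
            LateCollaredConfigurationC4 𝒟 k m₀ χ Λ δ γ N M a S p mo B Φ


/-- **10807‴ — `BondiBartnikRigidityC4` (engine; own-energy hypothesis; `N ≤ 1`; achronal leaf
of HONEST bounded geometry `Λ < 1` with an honest flat end; derivative loss `k' ≥ k` allowed, as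
filed).** For every margin, window, target order `k` and target `ε` there is an input order `k'`
such that for every `Λ < 1` and every profile `prof → 0` there are `δ, γ > 0` with: every corrected
configuration at order `k'` with `N ≤ 1` in an MGHD of admissible data whose leaf carries an honest
flat end of profile `prof` at order `k'` has an `(ε, k)`-near-Kerr leaf with the same `(N, M, a)` in
`J⁺(S)`. The competitor floor (KCM′, c3's text) and point-cone positivity turn the own-energy
hypothesis back into the filed gap form (`RESTATED_c3.lean`, `bondiBartnikGapLE_of_ownEnergy_of_KCM`),
so this is interchangeable with the 10807 leads' `BondiBartnikRigidityRepaired` (gap form, `Λ < 1`,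
`N ≤ 1`, `p` in the collar) given KCM′. -/
def BondiBartnikRigidityC4 : Prop :=
  ∀ (χ m₀ : ℝ) (k : ℕ) (ε : ℝ≥0∞), χ < 1 → 0 < m₀ → 0 < ε → ∃ k' : ℕ, ∀ Λ : ℝ≥0∞, Λ < 1 →
    ∀ prof : ℝ → ℝ≥0∞, Tendsto prof atTop (𝓝 0) →
    ∃ (δ : ℝ≥0∞) (γ : ℝ), 0 < δ ∧ 0 < γ ∧
      ∀ (X : Type) [TopologicalSpace X] [ChartedSpace E3 X] [IsManifold (𝓡 3) ∞ X] [T2Space X]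
        [SecondCountableTopology X] [ConnectedSpace X], ∀ D ∈ admissibleVacuumData X,
        ∀ (𝒟 : VacuumCauchyDevelopment D) (N : ℕ) (M a : Fin N → ℝ) (S : Set 𝒟.carrier)
          (p : 𝒟.carrier) (mo : Fin N → lorentzGroup × E4) (B : Fin N → ModelBackground)
          (Φ : ∀ i, (B i).domain → 𝒟.carrier), 𝒟.IsMaximal → N ≤ 1 →
          HasHonestFlatEnd 𝒟 k' S prof →
          LateCollaredConfigurationC4 𝒟 k' m₀ χ Λ δ γ N M a S p mo B Φ →
          ∃ S' : Set 𝒟.carrier, 𝒟.toCauchyDevelopment.IsNearKerrLeaf k ε N M a S' ∧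
            S' ⊆ 𝒟.metric.causalFuture 𝒟.timeOrientation S

/-- **`MultiCollarFate` — the exported multi-hole sector (F2 repaired; orders as the engine).**
For every admissible complete-`𝓘⁺` MGHD `𝒟` there is a hole bound `N₀'` (depending on `𝒟` only)
such that for every margin, window, target `(k, ε)` there is `k'` such that for every `Λ < 1` and
`prof → 0` there is `δ > 0` with: whenever `𝒟` contains a corrected configuration at order `k'`
with `N ≥ 2` whose leaf has an honest end of profile `prof`, some `(ε,k)`-near-Kerr leaf with at
most `N₀'` windowed margined holes lies in `J⁺(S)`. Multi-Kerr capture for developments that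
display two near-Kerr holes at some late time — the multi-body final-state problem in leaf form,
NOT a lemma; the planner may instead restrict the route to the `N ≤ 1` sector. -/
def MultiCollarFate : Prop :=
  ∀ (X : Type) [TopologicalSpace X] [ChartedSpace E3 X] [IsManifold (𝓡 3) ∞ X] [T2Space X]
    [SecondCountableTopology X] [ConnectedSpace X], ∀ D ∈ admissibleVacuumData X,
    ∀ 𝒟 : VacuumCauchyDevelopment D, 𝒟.IsMaximal →
      Summit.FinalStateConjecture.HasCompleteNullInfinity 𝒟.toCauchyDevelopment →
      ∃ N₀' : ℕ, ∀ (χ m₀ : ℝ) (k : ℕ) (ε : ℝ≥0∞), χ < 1 → 0 < m₀ → 0 < ε → ∃ k' : ℕ,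
        ∀ Λ : ℝ≥0∞, Λ < 1 → ∀ prof : ℝ → ℝ≥0∞, Tendsto prof atTop (𝓝 0) →
        ∃ δ : ℝ≥0∞, 0 < δ ∧
          ∀ (γ : ℝ) (N : ℕ) (M a : Fin N → ℝ) (S : Set 𝒟.carrier) (p : 𝒟.carrier)
            (mo : Fin N → lorentzGroup × E4) (B : Fin N → ModelBackground)
            (Φ : ∀ i, (B i).domain → 𝒟.carrier), 2 ≤ N →
            HasHonestFlatEnd 𝒟 k' S prof →
            LateCollaredConfigurationC4 𝒟 k' m₀ χ Λ δ γ N M a S p mo B Φ →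
            ∃ (N' : ℕ) (M' a' : Fin N' → ℝ) (S' : Set 𝒟.carrier), N' ≤ N₀' ∧
              (∀ i, m₀ ≤ M' i ∧ M' i ≤ m₀⁻¹ ∧ |a' i| ≤ χ * M' i) ∧
              𝒟.toCauchyDevelopment.IsNearKerrLeaf k ε N' M' a' S' ∧
              S' ⊆ 𝒟.metric.causalFuture 𝒟.timeOrientation S

/-! ## §3 `## Decomposition` of the census — the best typed split of the CONTENT, as signatures

The honest three-piece split every analysis of the item converges to (route TWO-LAYER PLAN
`LateBoundedLeaves → GapTendsToZero`; c0 `Sketch` A⁺/F⁺/K/P; MISSTATED-c1 R2/R3; ideator-2 S2(i)–(v)):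
EXISTENCE of late windowed collared leaves (compactness + eternal-silence rigidity, any `N`),
OWN-ENERGY exhaustion in the `N ≤ 1` sector (far share + no exterior reservoir), and — no longer a
piece of 10808 after R3 but the shared rank-2 crux O1 asks for — the competitor floor KCM′. The
glue `gapExhaustionC4_of_pieces` is proved; the pieces are NOT filed (the parent on the ledger is
the filed text, to which no honest glue exists, §0). -/

section Pieces

variable {X : Type} [TopologicalSpace X] [ChartedSpace E3 X] [IsManifold (𝓡 3) ∞ X]
  [ConnectedSpace X] {D : InitialDataSet (𝓡 3) X}

/-- **Late windowed collared configuration WITHOUT the energy clause** (the existence half):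
window, margin, achronal `(Λ,k)`-leaf through `p`, `N` thick collar charts `δ`-close at order `k`
with slabs in `S`, pairwise disjoint, and for `N ≤ 1` the probe point inside every collar. -/
def LateCollaredLeafOnly (𝒟 : VacuumCauchyDevelopment D) (k : ℕ) (m₀ χ : ℝ)
    (Λ δ : ℝ≥0∞) (N : ℕ) (M a : Fin N → ℝ) (S : Set 𝒟.carrier) (p : 𝒟.carrier)
    (mo : Fin N → lorentzGroup × E4) (B : Fin N → ModelBackground)
    (Φ : ∀ i, (B i).domain → 𝒟.carrier) : Prop :=
  (∀ i, m₀ ≤ M i ∧ M i ≤ m₀⁻¹ ∧ |a i| ≤ χ * M i) ∧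
  𝒟.toCauchyDevelopment.IsNearKerrLeaf k Λ N M a S ∧
  𝒟.metric.IsAchronal 𝒟.timeOrientation S ∧ p ∈ S ∧
  (∀ i, IsThickCollarChart 𝒟.toSpacetime k δ (M i) (a i) (mo i) (B i) (Φ i)) ∧
  (∀ i, Φ i '' (B i).truncTimeSlab (3 * M i) 0 ⊆ S) ∧
  Pairwise (Function.onFun Disjoint fun i => Φ i '' (B i).truncTimeSlab (3 * M i) 0) ∧
  (N ≤ 1 → ∀ i, p ∈ Φ i '' (B i).truncTimeSlab (3 * M i) 0)

end Pieces

/-- **Piece 1 — `LateCollaredLeavesC4` (existence; "the whole crux").** As `GapExhaustionC4` but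
the configuration carries no energy clause: late, achronal, windowed, margined near-Kerr collared
leaves with an honest flat end exist beyond every compact set, at every order, for every collar
tolerance `δ`. Content: bounded geometry of late hyperboloidal leaves (no Burnett cascade, finitely
many non-tiny holes) + near-zone `Cᵏ` settling along a subsequence (eternally silent near-Kerr ⇒
Kerr: the rigidity node both parked lines attack) — the non-perturbative approach to the stability
basin; summit-hard dynamics, no smallness anywhere. -/
def LateCollaredLeavesC4 : Prop :=
  ∀ (X : Type) [TopologicalSpace X] [ChartedSpace E3 X] [IsManifold (𝓡 3) ∞ X] [T2Space X]
    [SecondCountableTopology X] [ConnectedSpace X], ∀ D ∈ admissibleVacuumData X,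
    IsFarRegular D → ∀ 𝒟 : VacuumCauchyDevelopment D, 𝒟.IsMaximal →
      Summit.FinalStateConjecture.HasCompleteNullInfinity 𝒟.toCauchyDevelopment →
      WindowedCollarMargin 𝒟.toSpacetime →
      ∃ (m₀ χ : ℝ), 0 < m₀ ∧ χ < 1 ∧ ∀ k : ℕ, ∃ (Λ : ℝ≥0∞) (prof : ℝ → ℝ≥0∞), Λ < 1 ∧
        Tendsto prof atTop (𝓝 0) ∧
        ∀ δ : ℝ≥0∞, 0 < δ → ∀ K : Set 𝒟.carrier, IsCompact K →
          ∃ (N : ℕ) (M a : Fin N → ℝ) (S : Set 𝒟.carrier) (p : 𝒟.carrier)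
            (mo : Fin N → lorentzGroup × E4) (B : Fin N → ModelBackground)
            (Φ : ∀ i, (B i).domain → 𝒟.carrier),
            Disjoint (𝒟.metric.causalFuture 𝒟.timeOrientation S)
              (𝒟.metric.causalPast 𝒟.timeOrientation K) ∧
            HasHonestFlatEnd 𝒟 k S prof ∧
            LateCollaredLeafOnly 𝒟 k m₀ χ Λ δ N M a S p mo B Φ

/-- **Piece 2 — `OwnEnergyExhaustion` (far share + no reservoir, `N ≤ 1`).** For every far-regular
admissible complete-`𝓘⁺` MGHD, every window/margin, every order `k`, geometry bound, profile and
budget `γ > 0` there are a collar tolerance `δ' > 0` and a compact `K'` such that EVERY late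
(beyond `J⁻(K')`) achronal windowed collared leaf with `N ≤ 1`, `δ'`-close collars and an honest end
of the given profile has an own cut Bondi energy `≤ Σ Mᵢ + γ`: eventually nothing outside the
collar can still be shed (radiation has left: the far share, ideator-2's Cesàro `rᵖ` lever; no
eternal exterior reservoir: the near share) — in the `∀K ∃` (liminf) form this is uniform lateness,
which is what makes it a genuine piece and not the parent reworded. `N = 0`: final Bondi mass of a
horizonless far-regular complete-`𝓘⁺` development tends to `0` (≡ crux HorizonlessMustDrain of route
BondiDrainDispersal). Needs round-section families on late cones (R5) to be witnessable at all. -/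
def OwnEnergyExhaustion : Prop :=
  ∀ (X : Type) [TopologicalSpace X] [ChartedSpace E3 X] [IsManifold (𝓡 3) ∞ X] [T2Space X]
    [SecondCountableTopology X] [ConnectedSpace X], ∀ D ∈ admissibleVacuumData X,
    IsFarRegular D → ∀ 𝒟 : VacuumCauchyDevelopment D, 𝒟.IsMaximal →
      Summit.FinalStateConjecture.HasCompleteNullInfinity 𝒟.toCauchyDevelopment →
      ∀ (m₀ χ : ℝ) (k : ℕ) (Λ : ℝ≥0∞) (prof : ℝ → ℝ≥0∞) (γ : ℝ), 0 < m₀ → χ < 1 → 0 < γ →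
        ∃ (δ' : ℝ≥0∞) (K' : Set 𝒟.carrier), 0 < δ' ∧ IsCompact K' ∧
          ∀ (δ : ℝ≥0∞) (N : ℕ) (M a : Fin N → ℝ) (S : Set 𝒟.carrier) (p : 𝒟.carrier)
            (mo : Fin N → lorentzGroup × E4) (B : Fin N → ModelBackground)
            (Φ : ∀ i, (B i).domain → 𝒟.carrier), δ ≤ δ' → N ≤ 1 →
            Disjoint (𝒟.metric.causalFuture 𝒟.timeOrientation S)
              (𝒟.metric.causalPast 𝒟.timeOrientation K') →
            HasHonestFlatEnd 𝒟 k S prof →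
            LateCollaredLeafOnly 𝒟 k m₀ χ Λ δ N M a S p mo B Φ →
            ∃ m : ℝ, 𝒟.toCauchyDevelopment.HasCutBondiMass (collarCore M p B Φ) m ∧
              m ≤ (∑ i, M i) + γ

/-- **Competitor floor KCM′ (O1), windowed, for the record** — no longer consumed by the restated
10808 (R3: own-energy form) but the calibration both 10807′ and the filed gap clause presuppose:
every admissible MGHD containing a `δ`-near-Kerr thick collar of windowed label and margin has every
competitor mass `≥ M − ε` (`IsCompetitorMass`, `BondiBartnikGap.lean`). A null Penrose inequality
WITH angular momentum for thick collars; open even at `a = 0` beyond near-Schwarzschild cones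
(arXiv:1506.06400). Verbatim c0's `stub_kerrCollarMinimality`. -/
def KerrCollarMinimalityWindowed : Prop :=
  ∀ (χ m₀ ε : ℝ), χ < 1 → 0 < m₀ → 0 < ε → ∃ (k : ℕ) (δ : ℝ≥0∞), 0 < δ ∧
    ∀ (X : Type) [TopologicalSpace X] [ChartedSpace E3 X] [IsManifold (𝓡 3) ∞ X] [T2Space X]
      [SecondCountableTopology X] [ConnectedSpace X], ∀ D ∈ admissibleVacuumData X,
      ∀ (𝒟 : VacuumCauchyDevelopment D) (M a : ℝ) (mo : lorentzGroup × E4) (B : ModelBackground)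
        (Φ : B.domain → 𝒟.carrier), 𝒟.IsMaximal → m₀ ≤ M → M ≤ m₀⁻¹ → |a| ≤ χ * M →
        IsThickCollarChart 𝒟.toSpacetime k δ M a mo B Φ →
        ∀ m' : ℝ, 𝒟.IsCompetitorMass (Φ '' B.truncTimeSlab (3 * M) 0) m' → M - ε ≤ m'

/-- **Glue of the content split (proved): `LateCollaredLeavesC4 → OwnEnergyExhaustion →
GapExhaustionC4`.** Given `(δ, γ, K)`: piece 2 at the order-`k` data `(m₀, χ, Λ, prof, γ)` names
`(δ', K')`; piece 1 at tolerance `min δ δ'` beyond `J⁻(K ∪ K')` gives the configuration; for `N ≤ 1`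
piece 2 supplies the own-energy clause, for `N ≥ 2` none is owed. [folklore] -/
theorem gapExhaustionC4_of_pieces (h₁ : LateCollaredLeavesC4) (h₂ : OwnEnergyExhaustion) :
    GapExhaustionC4 := by
  intro X _ _ _ _ _ _ D hD hFR 𝒟 hmax hcni hWM
  obtain ⟨m₀, χ, hm₀, hχ, H1⟩ := h₁ X D hD hFR 𝒟 hmax hcni hWM
  refine ⟨m₀, χ, hm₀, hχ, fun k => ?_⟩
  obtain ⟨Λ, prof, hΛ, hprof, H1⟩ := H1 k
  refine ⟨Λ, prof, hΛ, hprof, fun δ γ hδ hγ K hK => ?_⟩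
  obtain ⟨δ', K', hδ', hK', H2⟩ := h₂ X D hD hFR 𝒟 hmax hcni m₀ χ k Λ prof γ hm₀ hχ hγ
  obtain ⟨N, M, a, S, p, mo, B, Φ, hlate, hend, hconf⟩ :=
    H1 (min δ δ') (lt_min hδ hδ') (K ∪ K') (hK.union hK')
  have hlateK : Disjoint (𝒟.metric.causalFuture 𝒟.timeOrientation S)
      (𝒟.metric.causalPast 𝒟.timeOrientation K) :=
    hlate.mono_right (LorentzianMetric.causalFuture_mono subset_union_left)
  have hlateK' : Disjoint (𝒟.metric.causalFuture 𝒟.timeOrientation S)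
      (𝒟.metric.causalPast 𝒟.timeOrientation K') :=
    hlate.mono_right (LorentzianMetric.causalFuture_mono subset_union_right)
  obtain ⟨hwin, hleaf, hachr, hp, hch, hS, hdisj, hpin⟩ := hconf
  have hconf' : LateCollaredLeafOnly 𝒟 k m₀ χ Λ (min δ δ') N M a S p mo B Φ :=
    ⟨hwin, hleaf, hachr, hp, hch, hS, hdisj, hpin⟩
  have hE : N ≤ 1 → ∃ m : ℝ, 𝒟.toCauchyDevelopment.HasCutBondiMass (collarCore M p B Φ) m ∧
      m ≤ (∑ i, M i) + γ := fun hN1 =>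
    H2 (min δ δ') N M a S p mo B Φ (min_le_right _ _) hN1 hlateK' hend hconf'
  have hconf : LateCollaredConfigurationC4 𝒟 k m₀ χ Λ δ γ N M a S p mo B Φ :=
    ⟨hwin, hleaf, hachr, hp, fun i => (hch i).mono le_rfl (min_le_left _ _), hS, hdisj,
      fun hN1 => ⟨hpin hN1, hE hN1⟩⟩
  exact ⟨N, M, a, S, p, mo, B, Φ, hlateK, hend, hconf⟩

/-! ## §4 The restated chain closes against the CURRENT route (T2, rev 6): `SettledCapture`, TAME genericity -/

/-- **10809‴ in the T2 typing — `TameCensorshipFarRegularCollarMargin`**: tame-generically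
(`IsTameChristodoulouGeneric … 1`, one fixed end, as the re-typed summit demands) in the admissible
class, the datum is FAR-REGULAR (R7) and every MGHD has complete `𝓘⁺` AND the windowed collar
margin. The current route item `TameCensorshipCollarMargin` (stmt-17329) with the far-regularity
conjunct added and the margin windowed (AUDIT-c4 F6: far-wild tails are tame-non-generic via the
Corvino–Schoen receding family `+ c·f` for immersion). -/
def TameCensorshipFarRegularCollarMargin : Prop :=
  ∀ (X : Type) [TopologicalSpace X] [ChartedSpace E3 X] [IsManifold (𝓡 3) ∞ X] [T2Space X]
    [SecondCountableTopology X] [ConnectedSpace X],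
    InitialDataSet.IsTameChristodoulouGeneric (admissibleVacuumData X)
      (fun D => IsFarRegular D ∧ ∀ 𝒟 : VacuumCauchyDevelopment D, 𝒟.IsMaximal →
        Summit.FinalStateConjecture.HasCompleteNullInfinity 𝒟.toCauchyDevelopment ∧
        WindowedCollarMargin 𝒟.toSpacetime) 1

/-- **Assembly of the restated route against the CURRENT summit wiring (T2).**
`BondiBartnikRigidityC4 → GapExhaustionC4 → MultiCollarFate → SettledCapture →
TameCensorshipFarRegularCollarMargin → MGHDExists → FinalStateConjecture`: TAME Christodoulou
genericity is monotone under pointwise implication on the admissible class (end, family, tameness,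
immersion, injectivity kept; the block of the route's own `closes`); pointwise, MGHDExists gives the
development, 10809‴ gives far-regularity, complete `𝓘⁺` and the windowed margin; `MultiCollarFate`
gives the hole bound `N₀'` of `𝒟`; given `SettledCapture`'s request `(k, ε)`, the engine and the
multi-hole crux name input orders `k₁', k₂'`; 10808‴ at order `max k₁' k₂'` gives `(Λ < 1, prof → 0)`
and, at tolerance `min δ_BBR δ_MCF` and budget `γ_BBR`, beyond every `J⁻(K)` a configuration with
an honest end, transported DOWN to each consumer's order; branch `N ≤ 1`: the engine, branch
`N ≥ 2`: `MultiCollarFate`; either way an `(ε,k)`-leaf beyond `J⁻(K)` with at most `max 1 N₀'`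
windowed margined holes — `SettledCapture`'s hypothesis (its inlined leaf block is definitionally
`IsNearKerrLeaf`; its margin clause is served by the window, `k₁ := 0`, `ε₁ := ⊤`), whose conclusion
is the T2 settled clause verbatim. Axioms: propext, Classical.choice, Quot.sound. [folklore] -/
theorem closes_s1 : BondiBartnikRigidityC4 → GapExhaustionC4 → MultiCollarFate →
    SettledCapture → TameCensorshipFarRegularCollarMargin → MGHDExists → FinalStateConjecture := by
  intro h₁ h₂ hT h₃ h₄ h₅ X _ _ _ _ _ _
  have mono : ∀ {P Q : InitialDataSet (𝓡 3) X → Prop},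
      InitialDataSet.IsTameChristodoulouGeneric (admissibleVacuumData X) P 1 →
        (∀ D ∈ admissibleVacuumData X, P D → Q D) →
          InitialDataSet.IsTameChristodoulouGeneric (admissibleVacuumData X) Q 1 := by
    intro P Q h hPQ d hd
    obtain ⟨e, F, hT, hI, h0, hinj, hDF, hE⟩ := h d ⟨hd.1, fun hP => hd.2 (hPQ d hd.1 hP)⟩
    exact ⟨e, F, hT, hI, h0, hinj, hDF,
      fun c hc hc' => hE c hc ⟨hc'.1, fun hP => hc'.2 (hPQ _ hc'.1 hP)⟩⟩
  refine mono (h₄ X) ?_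
  intro D hD hP
  obtain ⟨hFR, hP⟩ := hP
  refine ⟨h₅ X D hD, fun 𝒟 hmax => ?_⟩
  obtain ⟨hCNI, hWM⟩ := hP 𝒟 hmax
  refine ⟨hCNI, h₃ X D hD 𝒟 hmax hCNI ?_⟩
  obtain ⟨N₀', HT⟩ := hT X D hD 𝒟 hmax hCNI
  obtain ⟨m₀, χ, hm₀, hχ, H2⟩ := h₂ X D hD hFR 𝒟 hmax hCNI hWM
  refine ⟨max 1 N₀', m₀, χ, 0, ⊤, hm₀, hχ, ENNReal.zero_lt_top, fun k ε hε K hK => ?_⟩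
  obtain ⟨k₁, H1⟩ := h₁ χ m₀ k ε hχ hm₀ hε
  obtain ⟨k₂, HT⟩ := HT χ m₀ k ε hχ hm₀ hε
  obtain ⟨Λ, prof, hΛ, hprof, H2⟩ := H2 (max k₁ k₂)
  obtain ⟨δ₁, γ, hδ₁, hγ, H1⟩ := H1 Λ hΛ prof hprof
  obtain ⟨δ₂, hδ₂, HT⟩ := HT Λ hΛ prof hprof
  obtain ⟨N, M, a, S, p, mo, B, Φ, hlate, hend, hconf⟩ :=
    H2 (min δ₁ δ₂) γ (lt_min hδ₁ hδ₂) hγ K hK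
  rcases Nat.lt_or_ge 1 N with hN2 | hN1
  · -- at least two collars: the exported sector, at order k₂
    obtain ⟨N', M', a', S', hN', hwin', hleaf', hS'⟩ :=
      HT γ N M a S p mo B Φ hN2 (hend.mono (le_max_right _ _))
        (hconf.mono (le_max_right _ _) (min_le_right _ _) le_rfl)
    refine ⟨N', M', a', S', hN'.trans (le_max_right _ _), fun i => ⟨(hwin' i).1, (hwin' i).2.1⟩,
      Disjoint.mono_left hS' hlate, ?_, fun _ _ i => (hwin' i).2.2⟩
    exact hleaf'
  · -- at most one collar: the engine, at order k₁
    obtain ⟨S', hleaf', hS'⟩ :=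
      H1 X D hD 𝒟 N M a S p mo B Φ hmax hN1 (hend.mono (le_max_left _ _))
        (hconf.mono (le_max_left _ _) (min_le_left _ _) le_rfl)
    refine ⟨N, M, a, S', hN1.trans (le_max_left _ _), fun i => ⟨(hconf.1 i).1, (hconf.1 i).2.1⟩,
      Disjoint.mono_left hS' hlate, ?_, fun _ _ i => (hconf.1 i).2.2⟩
    exact hleaf'

/-- **The filed items imply the T2-restated generic item's development-level clauses** where
comparable: the filed margin gives the windowed one (`windowedCollarMargin_of_collarMargin`); the
far-regularity conjunct is NEW content (admissibility is order `(2,1)` only,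
`isFarRegular_admissible_order_two`). Recorded so the tenure planner sees exactly what the
restatement adds to 10809. [folklore] -/
theorem windowed_of_filed_clause {X : Type} [TopologicalSpace X] [ChartedSpace E3 X]
    [IsManifold (𝓡 3) ∞ X] [ConnectedSpace X] {D : InitialDataSet (𝓡 3) X}
    (𝒟 : VacuumCauchyDevelopment D) (h : 𝒟.CollarMargin) :
    WindowedCollarMargin 𝒟.toSpacetime :=
  windowedCollarMargin_of_collarMargin h

/-! ## §5 `## Strengthen` of the census — S⁺ as a signature (flux domination), not filed -/

/-- **S⁺ — `FluxDominatedOwnEnergy` (Łojasiewicz / no-reservoir inequality).** The own-energy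
piece in a MORE RIGID form: for every far-regular admissible complete-`𝓘⁺` MGHD and every
order-`k` leaf datum `(m₀, χ, Λ, prof)` there are a modulus `ω → 0` (at `0⁺`), a collar tolerance
`δ'` and a compact `K'` such that on every late `N ≤ 1` windowed collared leaf, the Bondi energy of
the collar core IN EXCESS of the collar masses is dominated by the energy STILL TO BE RADIATED:
`m − Σ Mᵢ ≤ ω (m − m')` for every cut energy `m'` of any later core `C' ⊆ J⁺(core)`. With Bondi-mass
convergence along nested late cores (`m − m' → 0`, mass loss + positivity) it gives
`OwnEnergyExhaustion` at once — "settled means it cannot lose weight" read as an inequality. Its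
exact case (`m = m'` on an interval ⇒ `m = Σ Mᵢ` ⇒ with KCM′/10807′ a slice of Kerr) is the
Liouville theorem "non-radiating on a long interval ⇒ stationary near zone", i.e. unique
continuation from `𝓘⁺` (Alexakis–Ionescu–Klainerman type), known only perturbatively/analytically —
the added rigidity relocates the difficulty, it does not split it; and it presupposes the leaves
(piece 1). Typed for the census; not filed. -/
def FluxDominatedOwnEnergy : Prop :=
  ∀ (X : Type) [TopologicalSpace X] [ChartedSpace E3 X] [IsManifold (𝓡 3) ∞ X] [T2Space X]
    [SecondCountableTopology X] [ConnectedSpace X], ∀ D ∈ admissibleVacuumData X,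
    IsFarRegular D → ∀ 𝒟 : VacuumCauchyDevelopment D, 𝒟.IsMaximal →
      Summit.FinalStateConjecture.HasCompleteNullInfinity 𝒟.toCauchyDevelopment →
      ∀ (m₀ χ : ℝ) (k : ℕ) (Λ : ℝ≥0∞) (prof : ℝ → ℝ≥0∞), 0 < m₀ → χ < 1 →
        ∃ (wmod : ℝ → ℝ) (δ' : ℝ≥0∞) (K' : Set 𝒟.carrier),
          Tendsto wmod (𝓝[>] 0) (𝓝 0) ∧ 0 < δ' ∧ IsCompact K' ∧
          ∀ (δ : ℝ≥0∞) (N : ℕ) (M a : Fin N → ℝ) (S : Set 𝒟.carrier) (p : 𝒟.carrier)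
            (mo : Fin N → lorentzGroup × E4) (B : Fin N → ModelBackground)
            (Φ : ∀ i, (B i).domain → 𝒟.carrier), δ ≤ δ' → N ≤ 1 →
            Disjoint (𝒟.metric.causalFuture 𝒟.timeOrientation S)
              (𝒟.metric.causalPast 𝒟.timeOrientation K') →
            HasHonestFlatEnd 𝒟 k S prof →
            LateCollaredLeafOnly 𝒟 k m₀ χ Λ δ N M a S p mo B Φ →
            ∀ (m m' : ℝ) (C' : Set 𝒟.carrier),
              𝒟.toCauchyDevelopment.HasCutBondiMass (collarCore M p B Φ) m →
              C' ⊆ 𝒟.metric.causalFuture 𝒟.timeOrientation (collarCore M p B Φ) →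
              𝒟.toCauchyDevelopment.HasCutBondiMass C' m' →
              m - (∑ i, M i) ≤ wmod (m - m')

/-- **Bondi-mass convergence along nested late cores** (the input that cashes S⁺): for every
budget `γ` there is a compact `K'` beyond which any two causally nested cores have cut energies
within `γ` (Cauchy property of the monotone bounded Bondi mass; mass loss + positivity at cuts of
an arbitrary admissible MGHD — itself R5-level infrastructure, printed only for CK/Bondi–Sachs
spacetimes). -/
def BondiMassConvergesAlongCores : Prop :=
  ∀ (X : Type) [TopologicalSpace X] [ChartedSpace E3 X] [IsManifold (𝓡 3) ∞ X] [T2Space X]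
    [SecondCountableTopology X] [ConnectedSpace X], ∀ D ∈ admissibleVacuumData X,
    ∀ 𝒟 : VacuumCauchyDevelopment D, 𝒟.IsMaximal →
      Summit.FinalStateConjecture.HasCompleteNullInfinity 𝒟.toCauchyDevelopment →
      ∀ γ : ℝ, 0 < γ → ∃ K' : Set 𝒟.carrier, IsCompact K' ∧
        ∀ (C C' : Set 𝒟.carrier) (m m' : ℝ),
          Disjoint (𝒟.metric.causalFuture 𝒟.timeOrientation C)
            (𝒟.metric.causalPast 𝒟.timeOrientation K') →
          C' ⊆ 𝒟.metric.causalFuture 𝒟.timeOrientation C →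
          𝒟.toCauchyDevelopment.HasCutBondiMass C m →
          𝒟.toCauchyDevelopment.HasCutBondiMass C' m' → |m - m'| ≤ γ

/-! ## §6 `## Negation` of the census — the first constructive step of the counterexample, typed -/

/-- **First stub of a negation line: a far-WILD admissible datum exists** — an admissible
one-ended vacuum datum which is not far-regular (`C²`-quiet, `C³`-wild tail; MISSTATED-c1 D-F:
conformal method over the seed `δ + ρ⁻¹⁴ sin(ρ⁶) w₀`). The smallest piece of
`FarWildBlackHoleExists` and already beyond the tree (no conformal-method existence theorem, no
constructed inhabitant of `admissibleVacuumData` with a prescribed tail); the remaining pieces —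
a trapped region, an MGHD (`MGHDExists`, XL-open, plus `IsMaximal` of a CONCRETE development), its
complete `𝓘⁺` (censorship-level for large data), (W) geometric optics of the trains, (F) a Bondi
floor (area theorem + mass loss + round-section families, R5), (C) light competitors (Czimek-type
extension + CK) — are each open-ended infrastructure on the REFUTING side. None is a lemma toward
the crux: resolving them sharpens `¬ GapExhaustion` (filed), nothing else. -/
def FarWildAdmissibleDatumExists : Prop :=
  ∃ (X : Type) (_ : TopologicalSpace X) (_ : ChartedSpace E3 X) (_ : IsManifold (𝓡 3) ∞ X)
    (_ : T2Space X) (_ : SecondCountableTopology X) (_ : ConnectedSpace X)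
    (D : InitialDataSet (𝓡 3) X), D ∈ admissibleVacuumData X ∧ ¬ IsFarRegular D

/-- The restated crux is insensitive to far-wild data BY HYPOTHESIS (R7): on a datum that is not
far-regular `GapExhaustionC4` owes nothing — the bookkeeping defect of the filed text is removed by
fiat, and the genericity item (10809‴, `TameCensorshipFarRegularCollarMargin`) carries the claim
that such data are exceptional. [folklore] -/
theorem gapExhaustionC4_vacuous_on_farWild {X : Type} [TopologicalSpace X] [ChartedSpace E3 X]
    [IsManifold (𝓡 3) ∞ X] [T2Space X] [SecondCountableTopology X] [ConnectedSpace X]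
    {D : InitialDataSet (𝓡 3) X} (hW : ¬ IsFarRegular D) (P : Prop) :
    IsFarRegular D → P :=
  fun h => absurd h hW

end Summit.FinalStateConjecture.FinalStateConjecture.Cruxes.GapExhaustion.RestatedS1

end
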